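import Literature.AlgebraicGeometry.Frobenioids.KummerDualityOfCupProduct
import Literature.NumberTheory.GaloisRepresentations.ContinuousH1TrivialAction
import HarnessLib

/-!
# Frobenioids II, Def. 2.2 (ii): transport of the cup-product duality along condition (c) —
# `cupDual` for `H_A` is bijective iff the adjoint cup product of the profinite `H` is

Mochizuki, *The geometry of Frobenioids II*, Kyushu J. Math. **62** (2008), §2, Def. 2.2 (ii) p. 18: the
duality isomorphism `H¹(H_A, μ_N(A)) ⥲ H_A^ab ⊗ F_N(A)` is obtained from local Tate duality for the
(profinite) group `H` — "the cup product … determines an isomorphism `H¹(H, μ_N(A)) ⥲ H^ab ⊗ H²(H, μ_N(A))`"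
— TOGETHER WITH condition (c) (`H ↠ H_A` induces `H¹(H_A, μ_N) ⥲ H¹(H, μ_N)`, `H¹(H_A, ℤ/N) ⥲ H¹(H, ℤ/N)`,
`H²(H_A, μ_N) ↠ H²(H, μ_N)`, "so `F_N(A) ≅ H²(H, μ_N(A))`") [cite: MochizukiFrdII2008, Def 2.2 (ii) p.17].
Cell abc-iut, cross-layer row **L1-γ₁**, milestone M4 (ii), first half (seat abc-iut-L2-t12): the
TRANSPORT step, kernel-checked, for the input `hcup` of `Kummer.dualityIsoOfCupProduct`
(`KummerDualityOfCupProduct.lean`):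

* `Kummer.cocycleTrivToHom`, `Kummer.homToH1Triv_bijective` — `Hom(H_A^ab, ℤ/N) ⥲ H¹(H_A, ℤ/Nℤ)`
  (trivial coefficients: crossed homomorphisms are homomorphisms, coboundaries vanish);
* `Kummer.cupDualH N O H_A q` — the adjoint cup product `H¹(H, μ_N(A)) →+ (H¹(H, ℤ/N) →+ H²(H, μ_N(A)))`
  of `H` (coefficients through `q : H ↠ H_A`); `Kummer.infl_cupH2` — inflation commutes with the cup
  products (the trunk's `cupProduct_res`);
* **`Kummer.cupDual_bijective_iff_of_isCohSaturated (hc : IsCohSaturated N O H_A q) :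
  Bijective (cupDual N O H_A q) ↔ Bijective (cupDualH N O H_A q)`** — under (c), `cupDual` is conjugate
  to `cupDualH` by the three (c)-isomorphisms.

What remains for `hcup` at `Def22Context.ofLocalField` (M4 (ii), second half): `Bijective cupDualH` = local
Tate duality for `H ≅ Γ_{L^H}` with coefficients `μ_N`, `ℤ/N` in adjoint form — the trunk's
`localDuality_bijective` (`M = ℤ/N`, `M^D = Hom(ℤ/N, μ_N) ≅ μ_N`, up to the sign of graded commutativity)
once `H` is identified with an absolute Galois group of a local field. Hypothesis
`[LocallyCompactSpace H]` (`H` is profinite in print). Classical; nothing here concerns [IUTchIII].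
-/

noncomputable section

namespace Literature.AlgebraicGeometry.Frobenioids

namespace Kummer

open CategoryTheory Literature.NumberTheory.GaloisRepresentations

variable {Γ : Type} [Group Γ] [TopologicalSpace Γ] [DiscreteTopology Γ]
  (N : ℕ) (O : Type) [CommMonoid O] [MulDistribMulAction Γ O] (HA : Subgroup Γ)

/-! ### `Hom(H_A^ab, ℤ/N) ⥲ H¹(H_A, ℤ/Nℤ)` -/

/-- A continuous crossed homomorphism of `H_A` with trivial coefficients `ℤ/N` is a homomorphism
`H_A → ℤ/N`. [cite: MochizukiFrdII2008, Def 2.2 p.18] -/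
def cocycleTrivToMonoidHom (c : contOneCocycles (trivTopRep N HA)) : HA →* Multiplicative (ZMod N) where
  toFun h := Multiplicative.ofAdd (c.1 h)
  map_one' := by rw [contOneCocycles.apply_one]; rfl
  map_mul' g h := by
    change Multiplicative.ofAdd (c.1 (g * h)) = Multiplicative.ofAdd (c.1 g) * Multiplicative.ofAdd (c.1 h)
    rw [contOneCocycles.apply_mul_of_trivial (trivTopRep_ρ_apply N HA) c g h, ofAdd_add]

/-- … and descends to `H_A^ab → ℤ/N`. [cite: MochizukiFrdII2008, Def 2.2 p.18] -/
def cocycleTrivToHom (c : contOneCocycles (trivTopRep N HA)) : Additive (Abelianization HA) →+ ZMod N :=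
  MonoidHom.toAdditiveLeft (Abelianization.lift (cocycleTrivToMonoidHom N HA c))

omit [DiscreteTopology Γ] in
/-- `cocycleTrivToHom c [h] = c h`. [cite: MochizukiFrdII2008, Def 2.2 p.18] -/
@[simp] theorem cocycleTrivToHom_ofMul_of (c : contOneCocycles (trivTopRep N HA)) (h : HA) :
    cocycleTrivToHom N HA c (Additive.ofMul (Abelianization.of h)) = c.1 h := rfl

/-- `homToCocycleTriv ∘ cocycleTrivToHom = id`. [cite: MochizukiFrdII2008, Def 2.2 p.18] -/
theorem homToCocycleTriv_cocycleTrivToHom (c : contOneCocycles (trivTopRep N HA)) :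
    homToCocycleTriv N HA (cocycleTrivToHom N HA c) = c :=
  Subtype.ext (ContinuousMap.ext fun _ => rfl)

omit [TopologicalSpace Γ] [DiscreteTopology Γ] in
/-- Two homomorphisms `H_A^ab → ℤ/N` agreeing on the classes `[h]` are equal.
[cite: MochizukiFrdII2008, Def 2.2 p.18] -/
theorem hom_ext_of {χ χ' : Additive (Abelianization HA) →+ ZMod N}
    (h : ∀ g : HA, χ (Additive.ofMul (Abelianization.of g)) = χ' (Additive.ofMul (Abelianization.of g))) :
    χ = χ' := by
  apply AddMonoidHom.toMultiplicativeRight.injective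
  exact Abelianization.hom_ext _ _ (MonoidHom.ext fun g => congrArg Multiplicative.ofAdd (h g))

/-- **`Hom(H_A^ab, ℤ/N) ⥲ H¹(H_A, ℤ/Nℤ)`**: `homToH1Triv` is bijective (trivial coefficients: every class
is the class of a homomorphism, and homomorphisms with equal classes are equal — Serre I §2.3
"`H¹(G, A) = Hom(G, A)`"). [cite: MochizukiFrdII2008, Def 2.2 p.18] -/
theorem homToH1Triv_bijective : Function.Bijective (homToH1Triv N HA) := by
  constructor
  · intro χ χ' hχ
    have hc := oneCocycleClass_injective_of_trivial (trivTopRep N HA) (trivTopRep_ρ_apply N HA) hχ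
    exact hom_ext_of N HA fun g => by
      rw [← homToCocycleTriv_apply N HA χ g, ← homToCocycleTriv_apply N HA χ' g, hc]
  · intro y
    obtain ⟨c, rfl⟩ := oneCocycleClass_surjective _ y
    exact ⟨cocycleTrivToHom N HA c, by rw [homToH1Triv_apply, homToCocycleTriv_cocycleTrivToHom]⟩

/-! ### The adjoint cup product of `H` and its compatibility with inflation -/

variable {H : Type} [Group H] [TopologicalSpace H] [IsTopologicalGroup H] [LocallyCompactSpace H]
  (q : H →ₜ* HA)

/-- The pairing `μ_N(A) × ℤ/N → μ_N(A)` for `H` acting through `q : H → H_A`.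
[cite: MochizukiFrdII2008, Def 2.2 p.18] -/
abbrev muPowPairingH :
    ContPairing (TopRep.res (q : H →* HA) (muTopRep N O HA)) (TopRep.res (q : H →* HA) (trivTopRep N HA))
      (TopRep.res (q : H →* HA) (muTopRep N O HA)) :=
  (muPowPairing N O HA).restrict q

/-- **The adjoint cup product of `H`**: `H¹(H, μ_N(A)) →+ (H¹(H, ℤ/N) →+ H²(H, μ_N(A)))`, `a ↦ (b ↦ a ∪ b)`
("the cup product on group cohomology" of the profinite `H`, FrdII p. 18).
[cite: MochizukiFrdII2008, Def 2.2 p.18] -/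
def cupDualH : continuousCohomology 1 (TopRep.res (q : H →* HA) (muTopRep N O HA)) →+
    (continuousCohomology 1 (TopRep.res (q : H →* HA) (trivTopRep N HA)) →+
      continuousCohomology 2 (TopRep.res (q : H →* HA) (muTopRep N O HA))) :=
  AddMonoidHom.mk' (fun a => ((muPowPairingH N O HA q).cupProduct a).toAddMonoidHom) fun a a' => by
    ext b
    simp only [map_add, LinearMap.add_apply, LinearMap.toAddMonoidHom_coe, AddMonoidHom.add_apply]

omit [DiscreteTopology Γ] in
/-- `cupDualH a b = a ∪ b`. [cite: MochizukiFrdII2008, Def 2.2 p.18] -/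
@[simp] theorem cupDualH_apply (a : continuousCohomology 1 (TopRep.res (q : H →* HA) (muTopRep N O HA)))
    (b : continuousCohomology 1 (TopRep.res (q : H →* HA) (trivTopRep N HA))) :
    cupDualH N O HA q a b = (muPowPairingH N O HA q).cupProduct a b := rfl

/-- **Inflation commutes with the cup products**: `infl² (a ∪ b) = infl¹ a ∪ infl¹ b`
(the trunk's `cupProduct_res` along `q`). [cite: MochizukiFrdII2008, Def 2.2 (ii) p.17] -/
theorem infl_cupH2 (a : continuousCohomology 1 (muTopRep N O HA))
    (b : continuousCohomology 1 (trivTopRep N HA)) :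
    (infl HA q (muTopRep N O HA) 2).hom (cupH2 N O HA a b) =
      cupDualH N O HA q ((infl HA q (muTopRep N O HA) 1).hom a) ((infl HA q (trivTopRep N HA) 1).hom b) := by
  haveI : LocallyCompactSpace HA := locallyCompactSpace_of_discrete HA
  exact ContPairing.cupProduct_res (θ := q) (muPowPairing N O HA) a b

/-! ### Transport along condition (c) -/

variable {N O HA q}

omit [LocallyCompactSpace H] in
/-- `F_N(A) ⥲ H²(H, μ_N(A))` under (c) sends `[y]` to `infl² y`. [cite: MochizukiFrdII2008, Def 2.2 (ii) p.18] -/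
theorem fnEquivOfSurjective_toFN (hc : IsCohSaturated N O HA q) (y : continuousCohomology 2 (muTopRep N O HA)) :
    fnEquivOfSurjective N O HA q hc.surjective_two_mu (toFN N O HA q y) =
      (infl HA q (muTopRep N O HA) 2).hom y := rfl

/-- **The key square**: under the (c)-comparison maps, `cupDual a χ ↦ cupDualH (infl a) (infl [χ])` —
`γ (cupDual a χ) = cupDualH (infl¹ a) (infl¹ (homToH1Triv χ))` with `γ : F_N(A) ⥲ H²(H, μ_N(A))`.
[cite: MochizukiFrdII2008, Def 2.2 p.18] -/
theorem fnEquiv_cupDual (hc : IsCohSaturated N O HA q) (a : continuousCohomology 1 (muTopRep N O HA))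
    (χ : Additive (Abelianization HA) →+ ZMod N) :
    fnEquivOfSurjective N O HA q hc.surjective_two_mu (cupDual N O HA q a χ) =
      cupDualH N O HA q ((infl HA q (muTopRep N O HA) 1).hom a)
        ((infl HA q (trivTopRep N HA) 1).hom (homToH1Triv N HA χ)) := by
  rw [cupDual_apply, cupFN_apply, fnEquivOfSurjective_toFN hc, infl_cupH2]

/-- The (c)-isomorphism `α : H¹(H_A, μ_N(A)) ⥲ H¹(H, μ_N(A))`. [cite: MochizukiFrdII2008, Def 2.2 (ii) p.17] -/
def inflOneMuEquiv (hc : IsCohSaturated N O HA q) :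
    continuousCohomology 1 (muTopRep N O HA) ≃+
      continuousCohomology 1 (TopRep.res (q : H →* HA) (muTopRep N O HA)) :=
  AddEquiv.ofBijective (infl HA q (muTopRep N O HA) 1).hom.toLinearMap.toAddMonoidHom hc.bijective_one_mu

/-- The (c)-isomorphism `β : Hom(H_A^ab, ℤ/N) ⥲ H¹(H, ℤ/N)` (`homToH1Triv` then inflation).
[cite: MochizukiFrdII2008, Def 2.2 (ii) p.17] -/
def homTrivEquiv (hc : IsCohSaturated N O HA q) :
    (Additive (Abelianization HA) →+ ZMod N) ≃+
      continuousCohomology 1 (TopRep.res (q : H →* HA) (trivTopRep N HA)) :=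
  (AddEquiv.ofBijective (homToH1Triv N HA) (homToH1Triv_bijective N HA)).trans
    (AddEquiv.ofBijective (infl HA q (trivTopRep N HA) 1).hom.toLinearMap.toAddMonoidHom
      hc.bijective_one_triv)

/-- Conjugation of `Hom(−, −)` by the (c)-isomorphisms `β`, `γ`: an equivalence
`Hom(Hom(H_A^ab, ℤ/N), F_N(A)) ≃ Hom(H¹(H, ℤ/N), H²(H, μ_N(A)))`. [cite: MochizukiFrdII2008, Def 2.2 (ii) p.18] -/
def dualEquiv (hc : IsCohSaturated N O HA q) :
    ((Additive (Abelianization HA) →+ ZMod N) →+ FN N O HA q) ≃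
      (continuousCohomology 1 (TopRep.res (q : H →* HA) (trivTopRep N HA)) →+
        continuousCohomology 2 (TopRep.res (q : H →* HA) (muTopRep N O HA))) where
  toFun ψ := (fnEquivOfSurjective N O HA q hc.surjective_two_mu).toAddMonoidHom.comp
    (ψ.comp (homTrivEquiv hc).symm.toAddMonoidHom)
  invFun ψ' := (fnEquivOfSurjective N O HA q hc.surjective_two_mu).symm.toAddMonoidHom.comp
    (ψ'.comp (homTrivEquiv hc).toAddMonoidHom)
  left_inv ψ := by
    ext χ
    simp
  right_inv ψ' := by
    ext b
    simp

/-- `cupDualH ∘ α = dualEquiv ∘ cupDual`. [cite: MochizukiFrdII2008, Def 2.2 p.18] -/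
theorem cupDualH_comp_inflOneMuEquiv (hc : IsCohSaturated N O HA q) :
    (cupDualH N O HA q) ∘ (inflOneMuEquiv hc) = (dualEquiv hc) ∘ (cupDual N O HA q) := by
  funext a
  refine AddMonoidHom.ext fun b => ?_
  obtain ⟨χ, rfl⟩ := (homTrivEquiv hc).surjective b
  change cupDualH N O HA q ((infl HA q (muTopRep N O HA) 1).hom a) _ =
    fnEquivOfSurjective N O HA q hc.surjective_two_mu
      (cupDual N O HA q a ((homTrivEquiv hc).symm (homTrivEquiv hc χ)))
  rw [AddEquiv.symm_apply_apply, fnEquiv_cupDual hc]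
  rfl

/-- **Transport of the duality along (c)**: `cupDual` (for the finite quotient `H_A`, valued in `F_N(A)`)
is bijective iff the adjoint cup product `cupDualH` of `H` is — FrdII p. 18: local duality for `H`
"together with condition (c)" gives the isomorphism for `H_A`. [cite: MochizukiFrdII2008, Def 2.2 p.18] -/
theorem cupDual_bijective_iff_of_isCohSaturated (hc : IsCohSaturated N O HA q) :
    Function.Bijective (cupDual N O HA q) ↔ Function.Bijective (cupDualH N O HA q) := by
  have h := cupDualH_comp_inflOneMuEquiv hc
  constructor
  · intro hb
    have h2 : Function.Bijective ((cupDualH N O HA q) ∘ (inflOneMuEquiv hc)) := by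
      rw [h]; exact (dualEquiv hc).bijective.comp hb
    exact ((inflOneMuEquiv hc).toEquiv.bijective_comp _).1 h2
  · intro hb
    have h2 : Function.Bijective ((dualEquiv hc) ∘ (cupDual N O HA q)) := by
      rw [← h]; exact hb.comp (inflOneMuEquiv hc).bijective
    exact ((dualEquiv hc).comp_bijective _).1 h2

/-- **`hcup` from local duality for `H`**: under (c), bijectivity of the adjoint cup product of `H`
gives the input `hcup` of `Kummer.dualityIsoOfCupProduct`. [cite: MochizukiFrdII2008, Def 2.2 p.18] -/
theorem cupDual_bijective_of_isCohSaturated (hc : IsCohSaturated N O HA q)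
    (hH : Function.Bijective (cupDualH N O HA q)) : Function.Bijective (cupDual N O HA q) :=
  (cupDual_bijective_iff_of_isCohSaturated hc).2 hH

end Kummer

end Literature.AlgebraicGeometry.Frobenioids
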